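import Literature.RepresentationTheory.CompactGroups.CircleCharacters
import Literature.LinearAlgebra.Matrix.SimultaneousDiagonalization
import HarnessLib

/-!
# Characters of the unitary group `U(n)` factor through the determinant

For a finite index type `n` and the compact unitary group `U(n) = Matrix.unitaryGroup n ℂ`:

* **algebraic half** (any commutative monoid `A`, no topology): every monoid homomorphism
  `χ : U(n) →* A` factors through `det : U(n) →* S¹` — `UnitaryGroupChar.exists_comp_detCircle :
  ∃ ψ : Circle →* A, χ = ψ.comp detCircle`, with `ψ` unique when `n` is nonempty
  (`existsUnique_comp_detCircle`); in particular `χ` is trivial on `SU(n)`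
  (`map_eq_one_of_det_eq_one`).  Equivalently: the derived subgroup of `U(n)` contains `SU(n)`.
* **continuous characters**: if moreover `A = S¹` (or `A = ℂ`) and `χ` is continuous — indeed already if
  its restriction to one coordinate circle `z ↦ diag(1, …, z, …, 1)` is continuous — then
  `χ = det ^ m` for a unique `m : ℤ` (`exists_eq_detCircle_zpow`, `existsUnique_eq_detCircle_zpow`,
  `existsUnique_coe_eq_det_zpow`, `existsUnique_eq_det_zpow_complex`), and the two-factor form for
  `U(m) × U(n)` (`existsUnique_eq_det_zpow_prod`).

PROOF (elementary, kernel-checked; no Lie theory).  (i) The permutation matrix of a transposition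
`(a b)` is unitary and conjugates `diag(d)` to `diag(d ∘ (a b))`, so the value of `χ` on a coordinate
circle `diag(1, …, z, …, 1)` does not depend on the coordinate (`map_coordEmb_eq`); (ii) hence on the
diagonal torus `χ (diag d) = ψ (∏ᵢ dᵢ) = ψ (det (diag d))` with `ψ z := χ (diag(z, 1, …, 1))`
(`map_diagHom`); (iii) a unitary matrix `u` is normal, so `u + uᴴ` and `i (u − uᴴ)` are commuting
Hermitian matrices, simultaneously diagonalised by ONE unitary `U`
(`Literature.LinearAlgebra.Matrix.exists_unitaryGroup_forall_eq_conj_diagonal`), whence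
`u = U · diag(d) · U⁻¹` inside `U(n)` with unit entries `d` (`exists_conj_diagHom`), and
`χ u = χ (diag d) = ψ (det u)` because the target is commutative; (iv) for continuous `χ` the
character `ψ = χ ∘ (z ↦ diag(z,1,…,1))` of `S¹` is continuous, hence `z ↦ z ^ m`
(`CircleChar.existsUnique_zpow`, Bröcker–tom Dieck II (8.1)).

This is the full-group form of the torus-only statements
`Literature.Geometry.ComplexHyperbolic.BallModel.unitaryGroup_map_diagU3_eq` /
`exists_int_map_diagU3_eq_zpow` (there for `U(3)` on the diagonal torus).  Used by the Hodge-CM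
model-construction cell: the scalar by which two archimedean oscillator (Weil) representations of a
compact dual-pair member `U(n)` differ is a continuous character, hence a determinant power with an
INTEGER exponent (deletion path of the print row "N-W∞-c", and the characters `λ_V` of the seesaw
identity (⊗2)); nothing here is specific to that use.

Not here (do not cite this file for them): characters of the `p`-adic / finite-adelic unitary groups
`U(V)(F_v)`, `v ∤ ∞` (that they factor through `det` is a different statement with a different proof —
generation by unipotents / Kneser–Platonov — and is NOT implied by anything below); characters of the
non-compact real forms `U(p,q)` off the diagonal torus (see `UnitaryGroupTorusCharacters` for the torus of
`U(2,1)`); the second half of Bröcker–tom Dieck II (8.1) (characters of higher tori).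

References (context; nothing is cited as a hypothesis — everything below is proved):
T. Bröcker, T. tom Dieck, *Representations of Compact Lie Groups*, GTM 98 (1985) [BrockerTomDieck1985]:
I (1.8) (`U(n)`), II (8.1) (characters of `S¹`), IV (3.1)–(3.3) (diagonal maximal torus of `U(n)`, every
element conjugate into it, Weyl group = permutations of the diagonal). [folklore]
-/

set_option autoImplicit false

noncomputable section

open Matrix Complex ComplexConjugate

namespace Literature.RepresentationTheory.CompactGroups

namespace UnitaryGroupChar

variable {n : Type*} [Fintype n] [DecidableEq n]

/-! ### The determinant character `det : U(n) →* S¹` -/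

/-- The determinant of a unitary matrix has norm one. [folklore] -/
theorem norm_det_eq_one (u : Matrix.unitaryGroup n ℂ) : ‖(u : Matrix n n ℂ).det‖ = 1 :=
  CStarRing.norm_of_mem_unitary (Matrix.det_of_mem_unitary u.2)

/-- **The determinant character** `det : U(n) →* S¹`. [folklore] -/
def detCircle : Matrix.unitaryGroup n ℂ →* Circle where
  toFun u := ⟨(u : Matrix n n ℂ).det, mem_sphere_zero_iff_norm.2 (norm_det_eq_one u)⟩
  map_one' := Circle.ext <| by simp
  map_mul' u v := Circle.ext <| by simp [Matrix.det_mul]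

/-- Unfolding `detCircle`. [folklore] -/
@[simp] theorem coe_detCircle (u : Matrix.unitaryGroup n ℂ) :
    (detCircle u : ℂ) = (u : Matrix n n ℂ).det := rfl

/-- `detCircle` is continuous. [folklore] -/
theorem continuous_detCircle : Continuous (detCircle : Matrix.unitaryGroup n ℂ → Circle) :=
  Continuous.subtype_mk (continuous_subtype_val.matrix_det) _

/-- In `U(n)` the inverse is the conjugate transpose. [folklore] -/
theorem coe_inv (u : Matrix.unitaryGroup n ℂ) :
    ((u⁻¹ : Matrix.unitaryGroup n ℂ) : Matrix n n ℂ) = star (u : Matrix n n ℂ) := rfl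

/-! ### The diagonal torus `diag : (n → S¹) →* U(n)` -/

/-- A diagonal matrix with unit entries is unitary. [folklore] -/
theorem diagonal_coe_mem (d : n → Circle) :
    (diagonal fun i => (d i : ℂ)) ∈ Matrix.unitaryGroup n ℂ := by
  rw [Matrix.mem_unitaryGroup_iff, star_eq_conjTranspose, diagonal_conjTranspose,
    diagonal_mul_diagonal]
  have h : (fun i => (d i : ℂ) * star (fun i => (d i : ℂ)) i) = fun _ => 1 := by
    funext i
    change (d i : ℂ) * conj (d i : ℂ) = 1
    rw [← Circle.coe_inv_eq_conj, ← Circle.coe_mul, mul_inv_cancel, Circle.coe_one]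
  rw [h, diagonal_one]

/-- The diagonal unitary `diag(d)`, `d : n → S¹`. [folklore] -/
def diagU (d : n → Circle) : Matrix.unitaryGroup n ℂ := ⟨diagonal fun i => (d i : ℂ), diagonal_coe_mem d⟩

/-- The matrix of `diagU d`. [folklore] -/
@[simp] theorem coe_diagU (d : n → Circle) :
    (diagU d : Matrix n n ℂ) = diagonal fun i => (d i : ℂ) := rfl

/-- **The diagonal maximal torus** `(S¹)ⁿ →* U(n)`, `d ↦ diag(d)` (Bröcker–tom Dieck IV (3.1)). [folklore] -/
def diagHom : (n → Circle) →* Matrix.unitaryGroup n ℂ where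
  toFun := diagU
  map_one' := Subtype.ext <| by simp
  map_mul' d e := Subtype.ext <| by simp [diagonal_mul_diagonal]

/-- Unfolding `diagHom`. [folklore] -/
@[simp] theorem diagHom_apply (d : n → Circle) : diagHom d = diagU d := rfl

/-- `diagHom` is continuous. [folklore] -/
theorem continuous_diagHom : Continuous (diagHom : (n → Circle) → Matrix.unitaryGroup n ℂ) := by
  refine Continuous.subtype_mk ?_ _
  exact (continuous_pi fun i => continuous_subtype_val.comp (continuous_apply i)).matrix_diagonal

/-- `det (diag d) = ∏ᵢ dᵢ`. [folklore] -/
@[simp] theorem detCircle_diagHom (d : n → Circle) : detCircle (diagHom d) = ∏ i, d i := by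
  apply Circle.ext
  rw [coe_detCircle, diagHom_apply, coe_diagU, det_diagonal]
  exact (map_prod Circle.coeHom d Finset.univ).symm

/-- The coordinate circle `z ↦ diag(1, …, z, …, 1)` (`z` at `i`). [folklore] -/
def coordEmb (i : n) : Circle →* Matrix.unitaryGroup n ℂ :=
  diagHom.comp (MonoidHom.mulSingle (fun _ : n => Circle) i)

/-- Unfolding `coordEmb`. [folklore] -/
theorem coordEmb_apply (i : n) (z : Circle) : coordEmb i z = diagU (Pi.mulSingle i z) := rfl

/-- `coordEmb i` is continuous. [folklore] -/
theorem continuous_coordEmb (i : n) : Continuous (coordEmb i : Circle → Matrix.unitaryGroup n ℂ) := by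
  change Continuous fun z : Circle => diagHom (Pi.mulSingle i z)
  exact continuous_diagHom.comp (continuous_mulSingle (A := fun _ : n => Circle) i)

/-- `det (diag(1, …, z, …, 1)) = z`: the coordinate circles are sections of `det`. [folklore] -/
@[simp] theorem detCircle_coordEmb (i : n) (z : Circle) : detCircle (coordEmb i z) = z := by
  rw [coordEmb, MonoidHom.comp_apply, detCircle_diagHom, MonoidHom.mulSingle_apply,
    Fintype.prod_pi_mulSingle']

/-- `det : U(n) →* S¹` is surjective (`n` nonempty). [folklore] -/
theorem detCircle_surjective [Nonempty n] :
    Function.Surjective (detCircle : Matrix.unitaryGroup n ℂ → Circle) := fun z =>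
  ⟨coordEmb (Classical.arbitrary n) z, detCircle_coordEmb _ z⟩

/-! ### Transpositions: the Weyl group permutes the torus coordinates -/

/-- The permutation matrix of a transposition is unitary. [folklore] -/
theorem swap_mem (a b : n) : Matrix.swap ℂ a b ∈ Matrix.unitaryGroup n ℂ := by
  rw [Matrix.mem_unitaryGroup_iff, star_eq_conjTranspose, conjTranspose_swap, swap_mul_self]

/-- The transposition `(a b)` as an element of `U(n)` (Bröcker–tom Dieck IV (3.3)). [folklore] -/
def swapU (a b : n) : Matrix.unitaryGroup n ℂ := ⟨Matrix.swap ℂ a b, swap_mem a b⟩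

/-- The matrix of `swapU a b`. [folklore] -/
@[simp] theorem coe_swapU (a b : n) : (swapU a b : Matrix n n ℂ) = Matrix.swap ℂ a b := rfl

/-- Conjugating a diagonal matrix by a transposition permutes its entries. [folklore] -/
theorem swap_mul_diagonal_mul_swap (a b : n) (d : n → ℂ) :
    Matrix.swap ℂ a b * diagonal d * Matrix.swap ℂ a b = diagonal (d ∘ Equiv.swap a b) := by
  rw [Matrix.swap, Equiv.Perm.permMatrix, PEquiv.toMatrix_toPEquiv_mul,
    PEquiv.mul_toMatrix_toPEquiv, Equiv.symm_swap, submatrix_submatrix]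
  simp [submatrix_diagonal_equiv]

/-- In `U(n)`: `s · diag(d) · s⁻¹ = diag(d ∘ (a b))` for the transposition `s = swapU a b`. [folklore] -/
theorem swapU_mul_diagU_mul_inv (a b : n) (d : n → Circle) :
    swapU a b * diagU d * (swapU a b)⁻¹ = diagU (d ∘ Equiv.swap a b) := by
  apply Subtype.ext
  change Matrix.swap ℂ a b * (diagonal fun i => (d i : ℂ)) * star (Matrix.swap ℂ a b) = diagonal _
  rw [star_eq_conjTranspose, conjTranspose_swap, swap_mul_diagonal_mul_swap]
  rfl

/-! ### Homomorphisms to a commutative monoid factor through `det` -/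

section Algebraic

variable {A : Type*} [CommMonoid A] (χ : Matrix.unitaryGroup n ℂ →* A)

/-- A homomorphism to a commutative monoid is invariant under conjugation. [folklore] -/
theorem map_conj (g h : Matrix.unitaryGroup n ℂ) : χ (g * h * g⁻¹) = χ h := by
  rw [map_mul, map_mul, mul_comm (χ g), mul_assoc, ← map_mul, mul_inv_cancel, map_one, mul_one]

/-- `χ (diag(d ∘ (a b))) = χ (diag d)`. [folklore] -/
theorem map_diagU_comp_swap (a b : n) (d : n → Circle) :
    χ (diagU (d ∘ Equiv.swap a b)) = χ (diagU d) := by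
  rw [← swapU_mul_diagU_mul_inv, map_conj]

/-- **The value of `χ` on a coordinate circle does not depend on the coordinate**:
`χ (diag(…, z at i, …)) = χ (diag(…, z at j, …))`. [folklore] -/
theorem map_coordEmb_eq (i j : n) (z : Circle) : χ (coordEmb i z) = χ (coordEmb j z) := by
  rw [coordEmb_apply, coordEmb_apply, ← map_diagU_comp_swap χ i j (Pi.mulSingle i z)]
  congr 2
  funext k
  simp only [Function.comp_apply, Pi.mulSingle_apply, Equiv.swap_apply_eq_iff, Equiv.swap_apply_left]

/-- **On the torus `χ` depends only on the product of the entries**: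
`χ (diag d) = χ (diag(∏ᵢ dᵢ, 1, …, 1))` (the `∏` placed at `i`). [folklore] -/
theorem map_diagHom (i : n) (d : n → Circle) : χ (diagHom d) = χ (coordEmb i (∏ j, d j)) := by
  calc χ (diagHom d) = (χ.comp diagHom) (∏ j, Pi.mulSingle j (d j)) := by
        rw [MonoidHom.comp_apply, Finset.univ_prod_mulSingle]
    _ = ∏ j, χ (coordEmb j (d j)) := by rw [map_prod]; rfl
    _ = ∏ j, (χ.comp (coordEmb i)) (d j) :=
        Finset.prod_congr rfl fun j _ => map_coordEmb_eq χ j i (d j)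
    _ = χ (coordEmb i (∏ j, d j)) := by rw [← map_prod, MonoidHom.comp_apply]

/-- **Unitary diagonalisation inside `U(n)`**: every `u ∈ U(n)` is `U · diag(d) · U⁻¹` with `U ∈ U(n)` and
unit entries `d` (Bröcker–tom Dieck IV (3.1) with (1.6): every element is conjugate into the maximal
torus).  From the simultaneous diagonalisation of the commuting Hermitian pair `u + uᴴ`, `i(u − uᴴ)`. [folklore] -/
theorem exists_conj_diagHom (u : Matrix.unitaryGroup n ℂ) :
    ∃ (U : Matrix.unitaryGroup n ℂ) (d : n → Circle), u = U * diagHom d * U⁻¹ := by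
  -- the Hermitian and (`i` times the) anti-Hermitian parts of the normal matrix `u`
  set M : Matrix n n ℂ := (u : Matrix n n ℂ) with hM
  have hnormal : M * Mᴴ = Mᴴ * M := by
    have h1 : M * Mᴴ = 1 := by
      rw [← star_eq_conjTranspose]; exact Matrix.mem_unitaryGroup_iff.1 u.2
    have h2 : Mᴴ * M = 1 := by
      rw [← star_eq_conjTranspose]; exact Matrix.mem_unitaryGroup_iff'.1 u.2
    rw [h1, h2]
  set F : Fin 2 → Matrix n n ℂ := ![M + Mᴴ, I • (M - Mᴴ)] with hF
  have hH : ∀ k, (F k).IsHermitian := by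
    intro k
    fin_cases k
    · simp only [hF, Fin.zero_eta, Matrix.cons_val_zero, IsHermitian, conjTranspose_add,
        conjTranspose_conjTranspose, add_comm]
    · simp only [hF, Fin.mk_one, Matrix.cons_val_one, Matrix.cons_val_zero, IsHermitian,
        conjTranspose_smul, conjTranspose_sub, conjTranspose_conjTranspose, Complex.star_def,
        Complex.conj_I, smul_sub, neg_smul]
      abel
  have hC : ∀ k l, Commute (F k) (F l) := by
    have h01 : (M + Mᴴ) * (I • (M - Mᴴ)) = (I • (M - Mᴴ)) * (M + Mᴴ) := by
      simp only [Matrix.mul_smul, Matrix.smul_mul, add_mul, mul_add, mul_sub, sub_mul, hnormal]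
    intro k l
    fin_cases k <;> fin_cases l
    · exact Commute.refl _
    · exact h01
    · exact h01.symm
    · exact Commute.refl _
  obtain ⟨U, hU, e, he⟩ :=
    Literature.LinearAlgebra.Matrix.exists_unitaryGroup_forall_eq_conj_diagonal F hH hC
  -- the eigenvalue function of `M = ((M + Mᴴ) - i · i(M - Mᴴ)) / 2`
  set d : n → ℂ := fun k => ((e 0 k : ℂ) - I * (e 1 k : ℂ)) / 2 with hd
  have hMd : M = U * diagonal d * star U := by
    have h0 : M + Mᴴ = U * diagonal (fun k => ((e 0 k : ℝ) : ℂ)) * star U := he 0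
    have h1 : I • (M - Mᴴ) = U * diagonal (fun k => ((e 1 k : ℝ) : ℂ)) * star U := he 1
    have h2 : (2 : ℂ) • M = (M + Mᴴ) - I • (I • (M - Mᴴ)) := by
      rw [smul_smul, I_mul_I, neg_smul, one_smul, sub_neg_eq_add, two_smul]; abel
    have hlin : ∀ (X Y : Matrix n n ℂ) (a : ℂ),
        U * (X - a • Y) * star U = U * X * star U - a • (U * Y * star U) := by
      intro X Y a
      rw [mul_sub, sub_mul, Matrix.mul_smul, Matrix.smul_mul]
    have h3 : (2 : ℂ) • M = U * ((diagonal fun k => ((e 0 k : ℝ) : ℂ)) -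
        I • diagonal fun k => ((e 1 k : ℝ) : ℂ)) * star U := by
      rw [hlin, ← h0, ← h1, h2]
    have h4 : ((diagonal fun k => ((e 0 k : ℝ) : ℂ)) - I • diagonal fun k => ((e 1 k : ℝ) : ℂ)) =
        (2 : ℂ) • diagonal d := by
      rw [← diagonal_smul, ← diagonal_smul, diagonal_sub]
      congr 1
      funext k
      simp only [Pi.smul_apply, smul_eq_mul, hd]
      ring
    rw [h4, Matrix.mul_smul, Matrix.smul_mul] at h3
    exact smul_right_injective (Matrix n n ℂ) (two_ne_zero (α := ℂ)) h3
  -- `diagonal d = U⋆ M U` is unitary, so the entries of `d` are units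
  have hDmem : diagonal d ∈ Matrix.unitaryGroup n ℂ := by
    have : diagonal d = star U * M * U := by
      rw [hMd, ← mul_assoc, ← mul_assoc, Unitary.star_mul_self_of_mem hU, one_mul, mul_assoc,
        Unitary.star_mul_self_of_mem hU, mul_one]
    rw [this]
    exact Submonoid.mul_mem _ (Submonoid.mul_mem _ (Unitary.star_mem hU) u.2) hU
  have hd1 : ∀ k, ‖d k‖ = 1 := by
    intro k
    have h := Matrix.mem_unitaryGroup_iff.1 hDmem
    rw [star_eq_conjTranspose, diagonal_conjTranspose, diagonal_mul_diagonal, ← diagonal_one,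
      diagonal_eq_diagonal_iff] at h
    have hk := h k
    rw [Pi.star_apply, Complex.star_def, Complex.mul_conj, ← Complex.ofReal_one, Complex.ofReal_inj,
      Complex.normSq_eq_norm_sq, pow_eq_one_iff_of_nonneg (norm_nonneg _) two_ne_zero] at hk
    exact hk
  refine ⟨⟨U, hU⟩, fun k => ⟨d k, mem_sphere_zero_iff_norm.2 (hd1 k)⟩, Subtype.ext ?_⟩
  change M = U * (diagonal fun k => d k) * star U
  exact hMd

/-- **`χ u` depends only on `det u`**: `χ u = χ (diag(det u, 1, …, 1))`. [folklore] -/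
theorem map_eq_map_coordEmb_detCircle (i : n) (u : Matrix.unitaryGroup n ℂ) :
    χ u = χ (coordEmb i (detCircle u)) := by
  obtain ⟨U, d, rfl⟩ := exists_conj_diagHom u
  have hdet : detCircle (U * diagHom d * U⁻¹) = ∏ j, d j := by
    rw [map_mul, map_mul, map_inv, detCircle_diagHom, mul_inv_cancel_comm]
  rw [map_conj, map_diagHom χ i, hdet]

/-- **`χ` is trivial on `SU(n)`.** [folklore] -/
theorem map_eq_one_of_det_eq_one (u : Matrix.unitaryGroup n ℂ) (hu : (u : Matrix n n ℂ).det = 1) : χ u = 1 := by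
  rcases isEmpty_or_nonempty n with hn | ⟨⟨i⟩⟩
  · have : u = 1 := Subtype.ext (Subsingleton.elim _ _)
    rw [this, map_one]
  · have hdet : detCircle u = 1 := Circle.ext (by simpa using hu)
    rw [map_eq_map_coordEmb_detCircle χ i, hdet, map_one, map_one]

/-- Two elements of `U(n)` with the same determinant have the same image. [folklore] -/
theorem map_eq_map_of_det_eq (u v : Matrix.unitaryGroup n ℂ)
    (h : (u : Matrix n n ℂ).det = (v : Matrix n n ℂ).det) : χ u = χ v := by
  rcases isEmpty_or_nonempty n with hn | ⟨⟨i⟩⟩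
  · rw [Subsingleton.elim u v]
  · have hdet : detCircle u = detCircle v := Circle.ext (by simpa using h)
    rw [map_eq_map_coordEmb_detCircle χ i u, map_eq_map_coordEmb_detCircle χ i v, hdet]

/-- **Factorisation through `det`.** Every homomorphism `U(n) → A` to a commutative monoid is
`ψ ∘ det` for some `ψ : S¹ →* A`. [folklore] -/
theorem exists_comp_detCircle : ∃ ψ : Circle →* A, χ = ψ.comp detCircle := by
  rcases isEmpty_or_nonempty n with hn | ⟨⟨i⟩⟩
  · refine ⟨1, MonoidHom.ext fun u => ?_⟩
    have : u = 1 := Subtype.ext (Subsingleton.elim _ _)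
    rw [this, map_one, map_one]
  · exact ⟨χ.comp (coordEmb i), MonoidHom.ext fun u => by
      simpa using map_eq_map_coordEmb_detCircle χ i u⟩

/-- Any factorisation `χ = ψ ∘ det` has `ψ = χ ∘ (z ↦ diag(z, 1, …, 1))`. [folklore] -/
theorem eq_comp_coordEmb_of_eq_comp (i : n) {ψ : Circle →* A} (h : χ = ψ.comp detCircle) :
    ψ = χ.comp (coordEmb i) := by
  ext z
  rw [h, MonoidHom.comp_apply, MonoidHom.comp_apply, detCircle_coordEmb]

/-- **Unique factorisation through `det`** (`n` nonempty). [folklore] -/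
theorem existsUnique_comp_detCircle [Nonempty n] : ∃! ψ : Circle →* A, χ = ψ.comp detCircle := by
  obtain ⟨ψ, hψ⟩ := exists_comp_detCircle χ
  refine ⟨ψ, hψ, fun ψ' hψ' => ?_⟩
  rw [eq_comp_coordEmb_of_eq_comp χ (Classical.arbitrary n) hψ',
    eq_comp_coordEmb_of_eq_comp χ (Classical.arbitrary n) hψ]

end Algebraic

/-! ### Continuous characters are integral powers of `det` -/

section Continuous

/-- **A character of `U(n)` continuous on one coordinate circle is `det ^ m`, `m ∈ ℤ` unique.** [folklore] -/
theorem existsUnique_eq_detCircle_zpow_of_continuous_comp (χ : Matrix.unitaryGroup n ℂ →* Circle) (i : n)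
    (hc : Continuous fun z : Circle => χ (coordEmb i z)) :
    ∃! m : ℤ, ∀ u, χ u = detCircle u ^ m := by
  obtain ⟨m, hm, huniq⟩ := CircleChar.existsUnique_zpow (χ.comp (coordEmb i)) hc
  refine ⟨m, fun u => ?_, fun m' hm' => huniq m' fun z => ?_⟩
  · rw [map_eq_map_coordEmb_detCircle χ i u]
    exact hm (detCircle u)
  · have h := hm' (coordEmb i z)
    rwa [detCircle_coordEmb] at h

/-- **Continuous characters of `U(n)` are integral powers of the determinant**:
`∃ m : ℤ, χ = det ^ m`. [cite: BrockerTomDieck1985, Ch. II Prop. 8.1 with Ch. IV (3.1)] [folklore] -/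
theorem exists_eq_detCircle_zpow (χ : Matrix.unitaryGroup n ℂ →* Circle) (hχ : Continuous χ) :
    ∃ m : ℤ, ∀ u, χ u = detCircle u ^ m := by
  rcases isEmpty_or_nonempty n with hn | ⟨⟨i⟩⟩
  · refine ⟨0, fun u => ?_⟩
    have : u = 1 := Subtype.ext (Subsingleton.elim _ _)
    rw [this, map_one, zpow_zero]
  · exact (existsUnique_eq_detCircle_zpow_of_continuous_comp χ i (hχ.comp (continuous_coordEmb i))).exists

/-- **Classification of the continuous characters of `U(n)`** (`n` nonempty): `∃! m : ℤ, χ = det ^ m` — the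
character group of `U(n)` is `ℤ`, generated by `det`. [cite: BrockerTomDieck1985, Ch. II Prop. 8.1 with
Ch. IV (3.1)] [folklore] -/
theorem existsUnique_eq_detCircle_zpow [Nonempty n] (χ : Matrix.unitaryGroup n ℂ →* Circle)
    (hχ : Continuous χ) : ∃! m : ℤ, ∀ u, χ u = detCircle u ^ m :=
  existsUnique_eq_detCircle_zpow_of_continuous_comp χ (Classical.arbitrary n)
    (hχ.comp (continuous_coordEmb _))

/-- The same with values read in `ℂ`: `(χ u : ℂ) = (det u) ^ m`. [folklore] -/
theorem existsUnique_coe_eq_det_zpow [Nonempty n] (χ : Matrix.unitaryGroup n ℂ →* Circle)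
    (hχ : Continuous χ) : ∃! m : ℤ, ∀ u, (χ u : ℂ) = (u : Matrix n n ℂ).det ^ m := by
  obtain ⟨m, hm, huniq⟩ := existsUnique_eq_detCircle_zpow χ hχ
  refine ⟨m, fun u => ?_, fun m' hm' => huniq m' fun u => Circle.ext ?_⟩
  · rw [hm u, Circle.coe_zpow, coe_detCircle]
  · rw [hm' u, Circle.coe_zpow, coe_detCircle]

/-- A continuous multiplicative character `U(n) → ℂ` is unitary. [folklore] -/
theorem norm_map_eq_one (χ : Matrix.unitaryGroup n ℂ →* ℂ) (hχ : Continuous χ)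
    (u : Matrix.unitaryGroup n ℂ) : ‖χ u‖ = 1 := by
  rcases isEmpty_or_nonempty n with hn | ⟨⟨i⟩⟩
  · have : u = 1 := Subtype.ext (Subsingleton.elim _ _)
    rw [this, map_one, norm_one]
  · rw [map_eq_map_coordEmb_detCircle χ i u]
    exact CircleChar.norm_eq_one (χ.comp (coordEmb i)) (hχ.comp (continuous_coordEmb i)) _

/-- **Continuous characters `U(n) → ℂ`** (`n` nonempty): `∃! m : ℤ, χ u = (det u) ^ m`. [folklore] -/
theorem existsUnique_eq_det_zpow_complex [Nonempty n] (χ : Matrix.unitaryGroup n ℂ →* ℂ)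
    (hχ : Continuous χ) : ∃! m : ℤ, ∀ u, χ u = (u : Matrix n n ℂ).det ^ m := by
  set i : n := Classical.arbitrary n
  obtain ⟨m, hm, huniq⟩ :=
    CircleChar.existsUnique_zpow_complex (χ.comp (coordEmb i)) (hχ.comp (continuous_coordEmb i))
  refine ⟨m, fun u => ?_, fun m' hm' => huniq m' fun z => ?_⟩
  · rw [map_eq_map_coordEmb_detCircle χ i u]
    simpa using hm (detCircle u)
  · have h := hm' (coordEmb i z)
    rw [← coe_detCircle, detCircle_coordEmb] at h
    exact h

/-! ### Two factors: characters of `U(m) × U(n)` -/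

variable {m : Type*} [Fintype m] [DecidableEq m]

/-- **Continuous characters of `U(m) × U(n)`** (both index types nonempty) are `det₁ ^ a · det₂ ^ b` for a
unique pair of integers. [folklore] -/
theorem existsUnique_eq_det_zpow_prod [Nonempty m] [Nonempty n]
    (χ : Matrix.unitaryGroup m ℂ × Matrix.unitaryGroup n ℂ →* Circle) (hχ : Continuous χ) :
    ∃! ab : ℤ × ℤ, ∀ u v, χ (u, v) = detCircle u ^ ab.1 * detCircle v ^ ab.2 := by
  obtain ⟨a, ha, hua⟩ := existsUnique_eq_detCircle_zpow (χ.comp (MonoidHom.inl _ _))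
    (hχ.comp (continuous_id.prodMk continuous_const))
  obtain ⟨b, hb, hub⟩ := existsUnique_eq_detCircle_zpow (χ.comp (MonoidHom.inr _ _))
    (hχ.comp (continuous_const.prodMk continuous_id))
  refine ⟨(a, b), fun u v => ?_, fun ab hab => Prod.ext (hua _ fun u => ?_) (hub _ fun v => ?_)⟩
  · rw [← Prod.fst_mul_snd (u, v), map_mul]
    exact congrArg₂ (· * ·) (ha u) (hb v)
  · simpa using hab u 1
  · simpa using hab 1 v

end Continuous

end UnitaryGroupChar

end Literature.RepresentationTheory.CompactGroups

end
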